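import Literature.NumberTheory.Transcendental.KZFibredRelations
import Literature.NumberTheory.Transcendental.KZProductIdeal
import Literature.NumberTheory.Transcendental.KZRelationsLE
import Literature.NumberTheory.Transcendental.KZRulesAssociator

/-!
# `LogKernelConjecture` (stmt-KontsevichZagierPeriods-2837) — line `spectator-localisation`,
stub `stub_productFibred`: LEFT PRODUCTS FIBRE EVERY CERTIFICATE

`[t] * relations ⊆ fibredRelations` for every representation `t` of dimension `≥ 1`
(`stub_productFibred`, from `productFibred_of_mul_mem_fibredRelations_of_pos`): under a left product
the four moves become, respectively, domain additivity, integrand additivity (fibred generators in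
all dimensions), the block change of variables `(y, x) ↦ (y, Φ x)` — which fixes coordinate `0`
because it is a `y`-coordinate — and a Newton–Leibniz move along the last coordinate over the base
`τ × τ'` of dimension `≥ 1`. The move data are those of `KZ.of_mul_mem_relations_of_mem_*`
(KZProductIdeal.lean), re-assembled into the fibred generator sets (`KZ.fibredChangeOfVariablesRel`,
`KZ.fibredNewtonLeibnizRel`). Consequences recorded here: the `∃ c'` in the structural conjunct
`stub_spectatorFibration` is idle — the conjunct is exactly the MEMBERSHIP statement "every relation
among left `s`-products `[s]·c ∈ relations` is a fibred relation" (`productFibred_spectatorFibration_iff_membership`);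
unit spectators cancel (`productFibred_cancellation_of_isUnit`); one more left factor fibres any
certificate (`productFibred_of_mul_of_mul_mem_fibredRelations`). Proof found by the lead's wave-1
stub worker on `stub_spectatorFibration` (which itself stays open). [folklore]
-/

noncomputable section

open MeasureTheory Set
open Literature.NumberTheory.Transcendental

namespace Summit.KontsevichZagierPeriods.LiouvilleUnfolding.SpectatorLocalisation

variable {l n : ℕ}

/-! ## Generic-dimension constructors for the fibred generator sets -/

/-- A change of variables between representations of any positive dimension `D` whose map fixes
the coordinate `⟨0, _⟩` is a fibred change of variables (write `D = k + 1`). [folklore] -/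
theorem productFibred_of_sub_of_mem_fibredChangeOfVariablesRel_of_pos {D : ℕ} (hD : 0 < D)
    {R R' : KZ.IntegralRep D} {Ψ : (Fin D → ℝ) → (Fin D → ℝ)}
    {Ψ' : (Fin D → ℝ) → (Fin D → ℝ) →L[ℝ] (Fin D → ℝ)}
    (hΨ : IsSemialgebraicMapOn ℚ R.domain Ψ)
    (hΨ' : ∀ x ∈ R.domain, HasFDerivWithinAt Ψ (Ψ' x) R.domain x) (hinj : InjOn Ψ R.domain)
    (hdom : R'.domain = Ψ '' R.domain)
    (hf : ∀ x ∈ R.domain, R.integrand x = R'.integrand (Ψ x) * |(Ψ' x).det|)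
    (h0 : ∀ x ∈ R.domain, Ψ x ⟨0, hD⟩ = x ⟨0, hD⟩) :
    KZ.of R - KZ.of R' ∈ KZ.fibredChangeOfVariablesRel := by
  obtain ⟨k, rfl⟩ : ∃ k, D = k + 1 := ⟨D - 1, by omega⟩
  exact ⟨k, R, R', Ψ, Ψ', hΨ, hΨ', hinj, hdom, hf, fun x hx => h0 x hx, rfl⟩

/-- A Newton–Leibniz move over a base of any positive dimension `D` is a fibred Newton–Leibniz move
(write `D = k + 1`). [folklore] -/
theorem productFibred_of_sub_of_mem_fibredNewtonLeibnizRel_of_pos {D : ℕ} (hD : 0 < D)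
    {R : KZ.IntegralRep (D + 1)} {R' : KZ.IntegralRep D}
    (h : KZ.of R - KZ.of R' ∈ KZ.newtonLeibnizRel) :
    KZ.of R - KZ.of R' ∈ KZ.fibredNewtonLeibnizRel := by
  obtain ⟨k, rfl⟩ : ∃ k, D = k + 1 := ⟨D - 1, by omega⟩
  exact KZ.of_sub_of_mem_fibredNewtonLeibnizRel h

/-! ## The four moves under `[t] * ·`, landing in `fibredRelations` -/

open KZ.IntegralRep in
/-- **`[t] * (domain additivity)` is a fibred relation** (a domain-additivity instance, any
dimension of `t`). [folklore] -/
theorem productFibred_of_mul_mem_fibredRelations_of_mem_domainAddRel (t : KZ.IntegralRep l) {c : KZ.FormalRep}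
    (hc : c ∈ KZ.domainAddRel) : KZ.of t * c ∈ KZ.fibredRelations := by
  -- adapted from KZ.of_mul_mem_relations_of_mem_domainAddRel (KZProductIdeal.lean)
  have ht : t.LeftResolves := t.leftResolves
  obtain ⟨n, r, r₁, r₂, hdom, hnull, h₁, h₂, rfl⟩ := hc
  rw [mul_sub, mul_sub, KZ.of_mul_of, KZ.of_mul_of, KZ.of_mul_of]
  refine KZ.mem_fibredRelations_of_mem_domainAddRel
    ⟨l + n, t.prod r, t.prod r₁, t.prod r₂, ?_, ?_, ?_, ?_, rfl⟩
  · ext z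
    simp only [prod_domain, mem_prodDomain, hdom, mem_union]
    tauto
  · have hsub : (t.prod r₁).domain ∩ (t.prod r₂).domain =
        {z : Fin (l + n) → ℝ | (fun i => z (Fin.castAdd n i)) ∈ t.domain ∧
          (fun j => z (Fin.natAdd l j)) ∈ r₁.domain ∩ r₂.domain} := by
      ext z
      simp only [prod_domain, mem_inter_iff, mem_prodDomain, mem_setOf_eq]
      tauto
    rw [hsub, KZ.volume_cylinder, hnull, mul_zero]
  · intro z hz
    rw [ht.prod_integrand, ht.prod_integrand, prodFun_apply, prodFun_apply, h₁ hz.2]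
  · intro z hz
    rw [ht.prod_integrand, ht.prod_integrand, prodFun_apply, prodFun_apply, h₂ hz.2]

open KZ.IntegralRep in
/-- **`[t] * (integrand additivity)` is a fibred relation** (an integrand-additivity instance, any
dimension of `t`). [folklore] -/
theorem productFibred_of_mul_mem_fibredRelations_of_mem_integrandAddRel (t : KZ.IntegralRep l)
    {c : KZ.FormalRep} (hc : c ∈ KZ.integrandAddRel) : KZ.of t * c ∈ KZ.fibredRelations := by
  -- adapted from KZ.of_mul_mem_relations_of_mem_integrandAddRel (KZProductIdeal.lean)
  have ht : t.LeftResolves := t.leftResolves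
  obtain ⟨n, r, r₁, r₂, h₁, h₂, hadd, rfl⟩ := hc
  rw [mul_sub, mul_sub, KZ.of_mul_of, KZ.of_mul_of, KZ.of_mul_of]
  refine KZ.mem_fibredRelations_of_mem_integrandAddRel
    ⟨l + n, t.prod r, t.prod r₁, t.prod r₂, ?_, ?_, ?_, rfl⟩
  · ext z
    simp only [prod_domain, mem_prodDomain, h₁]
  · ext z
    simp only [prod_domain, mem_prodDomain, h₂]
  · intro z hz
    rw [ht.prod_integrand, ht.prod_integrand, ht.prod_integrand, Pi.add_apply, prodFun_apply,
      prodFun_apply, prodFun_apply, hadd hz.2, Pi.add_apply, mul_add]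

open KZ.IntegralRep in
/-- **`[t] * (Newton–Leibniz)` is a FIBRED Newton–Leibniz move when `dim t ≥ 1`**: the product
band `τ × band` is a band in the last coordinate over the base `τ × τ'` of dimension
`l + n ≥ 1`, with bounds `a ∘ pr₂ ≤ b ∘ pr₂` and primitive `g ⊗ F`. [folklore] -/
theorem productFibred_of_mul_mem_fibredRelations_of_mem_newtonLeibnizRel (t : KZ.IntegralRep l) (hl : 0 < l)
    {c : KZ.FormalRep} (hc : c ∈ KZ.newtonLeibnizRel) : KZ.of t * c ∈ KZ.fibredRelations := by
  -- adapted from KZ.of_mul_mem_relations_of_mem_newtonLeibnizRel (KZProductIdeal.lean)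
  have ht : t.LeftResolves := t.leftResolves
  obtain ⟨n, r, r', a, b, F, hF, ha, hb, hab, hdom, hcont, hderiv, hr', rfl⟩ := hc
  rw [mul_sub, KZ.of_mul_of, KZ.of_mul_of]
  refine KZ.mem_fibredRelations_of_mem_fibredNewtonLeibnizRel
    (productFibred_of_sub_of_mem_fibredNewtonLeibnizRel_of_pos (D := l + n) (by omega) ?_)
  refine ⟨l + n, t.prod r, t.prod r',
    fun z => a (fun j => z (Fin.natAdd l j)), fun z => b (fun j => z (Fin.natAdd l j)),
    fun w => t.integrand (fun i => w (Fin.castAdd (n + 1) i)) * F (fun j => w (Fin.natAdd l j)),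
    ?_, ?_, ?_, ?_, ?_, ?_, ?_, ?_, rfl⟩
  · exact ht r.isSemialgebraic_domain hF
  · exact KZ.isSemialgebraicFunOn_cylinder_right t.isSemialgebraic_domain
      r'.isSemialgebraic_domain ha
  · exact KZ.isSemialgebraicFunOn_cylinder_right t.isSemialgebraic_domain
      r'.isSemialgebraic_domain hb
  · intro z hz
    exact hab _ hz.2
  · ext w
    simp only [prod_domain, mem_prodDomain, mem_setOf_eq, KZ.init_castAdd, KZ.init_natAdd, hdom,
      KZ.apply_natAdd_last]
    tauto
  · intro z hz
    simp only [Fin.snoc_castAdd, KZ.snoc_natAdd]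
    exact continuousOn_const.mul (hcont _ hz.2)
  · intro z hz s hs
    simp only [Fin.snoc_castAdd, KZ.snoc_natAdd]
    refine ((hderiv _ hz.2 s hs).const_mul
      (t.integrand fun i => z (Fin.castAdd n i))).congr_deriv ?_
    rw [ht.prod_integrand, prodFun_apply]
    simp only [Fin.snoc_castAdd, KZ.snoc_natAdd]
  · intro z hz
    rw [ht.prod_integrand, prodFun_apply, hr' _ hz.2, mul_sub]
    simp only [Fin.snoc_castAdd, KZ.snoc_natAdd]

open KZ.IntegralRep in
/-- **`[t] * (change of variables)` is a FIBRED change of variables when `dim t ≥ 1`**: the block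
map `Ψ (y, x) = (y, Φ x)` on `τ × σ` has all the properties of rule (2) (as in
`KZ.of_mul_mem_relations_of_mem_changeOfVariablesRel`) and fixes coordinate `0`, which is a
`y`-coordinate. [folklore] -/
theorem productFibred_of_mul_mem_fibredRelations_of_mem_changeOfVariablesRel (t : KZ.IntegralRep l) (hl : 0 < l)
    {c : KZ.FormalRep} (hc : c ∈ KZ.changeOfVariablesRel) : KZ.of t * c ∈ KZ.fibredRelations := by
  -- adapted from KZ.of_mul_mem_relations_of_mem_changeOfVariablesRel (KZProductIdeal.lean)
  have ht : t.LeftResolves := t.leftResolves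
  obtain ⟨n, r, r', Φ, Φ', hΦ, hΦ', hinj, hdom, hf, rfl⟩ := hc
  rw [mul_sub, KZ.of_mul_of, KZ.of_mul_of]
  -- the linear identification `ℝˡ × ℝⁿ ≃ ℝˡ⁺ⁿ`
  let e : ((Fin l → ℝ) × (Fin n → ℝ)) ≃ₗ[ℝ] (Fin (l + n) → ℝ) :=
    { toFun := fun p => Fin.append p.1 p.2
      invFun := fun z => (fun i => z (Fin.castAdd n i), fun j => z (Fin.natAdd l j))
      map_add' := fun p q => by
        ext i; refine Fin.addCases (fun i => ?_) (fun j => ?_) i <;> simp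
      map_smul' := fun c p => by
        ext i; refine Fin.addCases (fun i => ?_) (fun j => ?_) i <;> simp
      left_inv := fun p => by ext <;> simp
      right_inv := fun z => by
        ext i; refine Fin.addCases (fun i => ?_) (fun j => ?_) i <;> simp }
  let eL : ((Fin l → ℝ) × (Fin n → ℝ)) ≃L[ℝ] (Fin (l + n) → ℝ) := e.toContinuousLinearEquiv
  have heL : ∀ p, eL p = Fin.append p.1 p.2 := fun p => rfl
  have heL_symm : ∀ z, eL.symm z = (fun i => z (Fin.castAdd n i), fun j => z (Fin.natAdd l j)) :=
    fun z => rfl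
  -- the block map and its derivative
  let Ψ : (Fin (l + n) → ℝ) → (Fin (l + n) → ℝ) := eL ∘ Prod.map id Φ ∘ eL.symm
  let Ψ' : (Fin (l + n) → ℝ) → (Fin (l + n) → ℝ) →L[ℝ] (Fin (l + n) → ℝ) := fun z =>
    (eL : _ →L[ℝ] _).comp ((((ContinuousLinearMap.id ℝ (Fin l → ℝ)).prodMap
      (Φ' (fun j => z (Fin.natAdd l j)))).comp (eL.symm : _ →L[ℝ] _)))
  have hΨ : ∀ z, Ψ z = Fin.append (fun i => z (Fin.castAdd n i)) (Φ fun j => z (Fin.natAdd l j)) :=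
    fun z => rfl
  have hdet : ∀ z, (Ψ' z).det = (Φ' (fun j => z (Fin.natAdd l j))).det := by
    intro z
    have hcoe : ((Ψ' z : (Fin (l + n) → ℝ) →L[ℝ] (Fin (l + n) → ℝ)) :
        (Fin (l + n) → ℝ) →ₗ[ℝ] (Fin (l + n) → ℝ)) =
      (e : ((Fin l → ℝ) × (Fin n → ℝ)) →ₗ[ℝ] (Fin (l + n) → ℝ)) ∘ₗ
        (((LinearMap.id : (Fin l → ℝ) →ₗ[ℝ] (Fin l → ℝ)).prodMap
          ((Φ' (fun j => z (Fin.natAdd l j)) : (Fin n → ℝ) →L[ℝ] (Fin n → ℝ)) :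
            (Fin n → ℝ) →ₗ[ℝ] (Fin n → ℝ))) ∘ₗ
        (e.symm : (Fin (l + n) → ℝ) →ₗ[ℝ] ((Fin l → ℝ) × (Fin n → ℝ)))) :=
      LinearMap.ext fun v => rfl
    change LinearMap.det _ = LinearMap.det _
    rw [hcoe, LinearMap.det_conj, LinearMap.det_prodMap, LinearMap.det_id, one_mul]
  have hS : (t.prod r).domain = eL.symm ⁻¹' (t.domain ×ˢ r.domain) := rfl
  refine KZ.mem_fibredRelations_of_mem_fibredChangeOfVariablesRel
    (productFibred_of_sub_of_mem_fibredChangeOfVariablesRel_of_pos (D := l + n) (by omega)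
      (R := t.prod r) (R' := t.prod r') (Ψ := Ψ) (Ψ' := Ψ') ?_ ?_ ?_ ?_ ?_ ?_)
  · exact (KZ.isSemialgebraicMapOn_blockMap t.isSemialgebraic_domain hΦ).congr
      fun z _ => (hΨ z).symm
  · intro z hz
    have hx : (fun j => z (Fin.natAdd l j)) ∈ r.domain := hz.2
    have hg : HasFDerivWithinAt (Prod.map id Φ)
        ((ContinuousLinearMap.id ℝ (Fin l → ℝ)).prodMap (Φ' (fun j => z (Fin.natAdd l j))))
        (t.domain ×ˢ r.domain) (eL.symm z) := by
      refine HasFDerivWithinAt.prodMap (eL.symm z) (hasFDerivWithinAt_id _ _) ((hΦ' _ hx).mono ?_)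
      rintro _ ⟨q, hq, rfl⟩
      exact hq.2
    have h2 := (eL.comp_hasFDerivWithinAt_iff).mpr hg
    have h3 := (eL.symm.comp_right_hasFDerivWithinAt_iff (f := eL ∘ Prod.map id Φ)).mpr h2
    rw [hS]
    exact h3
  · intro z₁ hz₁ z₂ hz₂ h
    rw [hΨ, hΨ] at h
    have h' := congrArg (fun w : Fin (l + n) → ℝ =>
      ((fun i => w (Fin.castAdd n i)), (fun j => w (Fin.natAdd l j)))) h
    simp only [Fin.append_left, Fin.append_right, Prod.mk.injEq] at h'
    have h2 : (fun j => z₁ (Fin.natAdd l j)) = fun j => z₂ (Fin.natAdd l j) := hinj hz₁.2 hz₂.2 h'.2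
    rw [← Fin.append_castAdd_natAdd (f := z₁), ← Fin.append_castAdd_natAdd (f := z₂), h'.1, h2]
  · ext w
    simp only [prod_domain, mem_prodDomain, hdom, mem_image]
    constructor
    · rintro ⟨hw₁, x, hx, hwx⟩
      refine ⟨Fin.append (fun i => w (Fin.castAdd n i)) x,
        ⟨by simpa using hw₁, by simpa using hx⟩, ?_⟩
      rw [hΨ]
      simp only [Fin.append_left, Fin.append_right]
      conv_rhs => rw [← Fin.append_castAdd_natAdd (f := w)]
      simp [hwx]
    · rintro ⟨z, hz, rfl⟩
      rw [hΨ]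
      simp only [Fin.append_left, Fin.append_right]
      exact ⟨by simpa using hz.1, _, hz.2, rfl⟩
  · intro z hz
    rw [ht.prod_integrand, ht.prod_integrand, prodFun_apply, hf _ hz.2, hdet, hΨ, prodFun_append,
      mul_assoc]
  · intro z _
    have h0 : (⟨0, by omega⟩ : Fin (l + n)) = Fin.castAdd n ⟨0, hl⟩ := Fin.ext rfl
    rw [hΨ, h0, Fin.append_left]

/-! ## Assembly: left products by positive-dimensional representations fibre every certificate -/

/-- **`[t] * relations ⊆ fibredRelations` for `dim t ≥ 1`**: every relation of the KZ calculus
becomes, after a left product with a representation of positive dimension, a FIBRED relation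
(a chain of moves none of which touches the new coordinate `0`). By `AddSubgroup.closure_induction`
from the four generator lemmas above. [folklore] -/
theorem productFibred_of_mul_mem_fibredRelations_of_pos (t : KZ.IntegralRep l) (hl : 0 < l) {c : KZ.FormalRep}
    (hc : c ∈ KZ.relations) : KZ.of t * c ∈ KZ.fibredRelations := by
  refine AddSubgroup.closure_induction (fun x hx => ?_) ?_ (fun x y _ _ hx hy => ?_)
    (fun x _ hx => ?_) hc
  · rcases hx with ((hx | hx) | hx) | hx
    · exact productFibred_of_mul_mem_fibredRelations_of_mem_domainAddRel t hx
    · exact productFibred_of_mul_mem_fibredRelations_of_mem_integrandAddRel t hx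
    · exact productFibred_of_mul_mem_fibredRelations_of_mem_changeOfVariablesRel t hl hx
    · exact productFibred_of_mul_mem_fibredRelations_of_mem_newtonLeibnizRel t hl hx
  · rw [mul_zero]; exact KZ.fibredRelations.zero_mem
  · rw [mul_add]; exact KZ.fibredRelations.add_mem hx hy
  · rw [mul_neg]; exact KZ.fibredRelations.neg_mem hx

/-! ## The stub, and consequences for `stub_spectatorFibration` -/

/-- **Stub `stub_productFibred` — left products fibre every certificate**: for every representation
`t` of positive dimension and every relation `c`, `[t]·c` is a FIBRED relation. [folklore] -/
theorem stub_productFibred : ∀ (l : ℕ) (t : Literature.NumberTheory.Transcendental.KZ.IntegralRep l), 0 < l → ∀ c : Literature.NumberTheory.Transcendental.KZ.FormalRep, c ∈ Literature.NumberTheory.Transcendental.KZ.relations → Literature.NumberTheory.Transcendental.KZ.of t * c ∈ Literature.NumberTheory.Transcendental.KZ.fibredRelations :=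
  fun _ t hl _ hc => productFibred_of_mul_mem_fibredRelations_of_pos t hl hc

/-- **Unit spectators cancel**: if the class of `[s]` is a unit of the formal period ring
(`d * [s] ≡ [pt, 1]` for some `d`), then `[s]·c ∈ relations → c ∈ relations` (left ideal,
associativity and the left unit modulo relations). [folklore] -/
theorem productFibred_cancellation_of_isUnit {k : ℕ} (s : KZ.IntegralRep k) (d : KZ.FormalRep)
    (hd : d * KZ.of s - KZ.of KZ.IntegralRep.unit ∈ KZ.relations) (c : KZ.FormalRep)
    (hc : KZ.of s * c ∈ KZ.relations) : c ∈ KZ.relations := by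
  have h1 : d * (KZ.of s * c) ∈ KZ.relations := KZ.mul_mem_relations_left_holds _ _ hc
  have h2 : d * KZ.of s * c - d * (KZ.of s * c) ∈ KZ.relations :=
    KZ.mul_assoc_sub_mem_relations d (KZ.of s) c
  have h3 : (d * KZ.of s - KZ.of KZ.IntegralRep.unit) * c ∈ KZ.relations :=
    KZ.mul_mem_relations_right_holds _ _ hd
  have h4 : KZ.of KZ.IntegralRep.unit * c - c ∈ KZ.relations :=
    KZ.of_unit_mul_sub_mem_relations c
  have h5 : c = d * (KZ.of s * c) + (d * KZ.of s * c - d * (KZ.of s * c)) -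
      (d * KZ.of s - KZ.of KZ.IntegralRep.unit) * c - (KZ.of KZ.IntegralRep.unit * c - c) := by
    rw [sub_mul]; abel
  rw [h5]
  exact KZ.relations.sub_mem (KZ.relations.sub_mem (KZ.relations.add_mem h1 h2) h3) h4

/-- **Every certificate becomes fibred after one more left factor**: if `[s]·c ∈ relations` then
`[u]·([s]·c) ∈ fibredRelations` for every representation `u` of positive dimension (e.g. the unit
interval). The structural conjunct asks instead for fibredness over the coordinate of `s` itself,
i.e. on the other side of the block flip `u × s → s × u`, which is a change of variables moving
coordinate `0` and is not a fibred generator. [folklore] -/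
theorem productFibred_of_mul_of_mul_mem_fibredRelations {m : ℕ} (u : KZ.IntegralRep m) (hm : 0 < m)
    (s : KZ.IntegralRep 1) (c : KZ.FormalRep) (hc : KZ.of s * c ∈ KZ.relations) :
    KZ.of u * (KZ.of s * c) ∈ KZ.fibredRelations :=
  productFibred_of_mul_mem_fibredRelations_of_pos u hm hc

/-- **The `∃ c'` of the structural conjunct is idle**: since `[s]·relations ⊆ fibredRelations`, for
a fixed spectator `s` the conclusion `∃ c', c − c' ∈ relations ∧ [s]·c' ∈ fibredRelations` holds iff
`[s]·c` itself is a fibred relation. [folklore] -/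
theorem productFibred_spectatorFibration_pointwise_iff (s : KZ.IntegralRep 1) (c : KZ.FormalRep) :
    (∃ c' : KZ.FormalRep, c - c' ∈ KZ.relations ∧ KZ.of s * c' ∈ KZ.fibredRelations) ↔
      KZ.of s * c ∈ KZ.fibredRelations := by
  constructor
  · rintro ⟨c', hcc', hc'⟩
    have h1 : KZ.of s * (c - c') ∈ KZ.fibredRelations :=
      productFibred_of_mul_mem_fibredRelations_of_pos s one_pos hcc'
    have h2 : KZ.of s * c = KZ.of s * (c - c') + KZ.of s * c' := by rw [mul_sub, sub_add_cancel]
    rw [h2]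
    exact KZ.fibredRelations.add_mem h1 hc'
  · intro h
    exact ⟨c, by rw [sub_self]; exact KZ.relations.zero_mem, h⟩

/-- Hence the structural conjunct `stub_spectatorFibration` (verbatim on the left) is equivalent to
the MEMBERSHIP form "relations among left `s`-products are fibred" (`s.value ≠ 0`). [folklore] -/
theorem productFibred_spectatorFibration_iff_membership :
    (∀ (s : Literature.NumberTheory.Transcendental.KZ.IntegralRep 1) (c : Literature.NumberTheory.Transcendental.KZ.FormalRep), s.value ≠ 0 → Literature.NumberTheory.Transcendental.KZ.of s * c ∈ Literature.NumberTheory.Transcendental.KZ.relations → ∃ c' : Literature.NumberTheory.Transcendental.KZ.FormalRep, c - c' ∈ Literature.NumberTheory.Transcendental.KZ.relations ∧ Literature.NumberTheory.Transcendental.KZ.of s * c' ∈ Literature.NumberTheory.Transcendental.KZ.fibredRelations) ↔ ∀ (s : Literature.NumberTheory.Transcendental.KZ.IntegralRep 1) (c : Literature.NumberTheory.Transcendental.KZ.FormalRep), s.value ≠ 0 → Literature.NumberTheory.Transcendental.KZ.of s * c ∈ Literature.NumberTheory.Transcendental.KZ.relations → Literature.NumberTheory.Transcendental.KZ.of s *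 c ∈ Literature.NumberTheory.Transcendental.KZ.fibredRelations :=
  ⟨fun h s c hs hc => (productFibred_spectatorFibration_pointwise_iff s c).mp (h s c hs hc),
    fun h s c hs hc => (productFibred_spectatorFibration_pointwise_iff s c).mpr (h s c hs hc)⟩

end Summit.KontsevichZagierPeriods.LiouvilleUnfolding.SpectatorLocalisation
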